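import Mathlib
import HarnessLib
import Literature.GroupTheory.PermutationGroups.SmallIndexSubgroups

/-!
# ValiantsHypothesis / MonotoneRestoration — `MonotoneRestorationQP`, sparse supports have block monomials

Support file for crux item `stmt-ValiantsHypothesis-15886`
(`Summit.ValiantsHypothesis.ValiantsHypothesis.Theses.MonotoneRestoration.MonotoneRestorationQP`),
line `Sketch`, stub `stub_monotoneSupportReduction` (S5) in its quasi-polynomially SPARSE regime
(TTRL-lite variant V20164): the STRUCTURE of the monomials of a sparse matrix-symmetric polynomial.

If `f ∈ R[x_ij : i, j < n]` is invariant under the column permutations `x_ij ↦ x_i τ(j)` and has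
fewer than `C(n, k)` monomials (`n > 8`, `1 ≤ k`, `4k ≤ n`), then every monomial `m` of `f` has a
set `T` of fewer than `k` "special" columns outside of which its exponent matrix is constant along
every row (`m (i, j) = m (i, j')` for `j, j' ∉ T`); symmetrically for rows.  Hence a monomial of a
matrix-symmetric (`Sym_n × Sym_n`-invariant) sparse polynomial is a BLOCK MONOMIAL: an arbitrary
`S × T` corner, column exponents `c_j` on `(Fin n ∖ S) × T`, row exponents `r_i` on
`S × (Fin n ∖ T)` and one common exponent on `(Fin n ∖ S) × (Fin n ∖ T)`.

Proof: the column orbit of `m` stays inside the support (invariance + `coeff_rename_mapDomain`),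
so the column stabiliser of `m` has index `≤ |supp f| < C(n, k)` (orbit–stabiliser counting on
left cosets) and Dixon–Mortimer 5.2B
(`Literature.GroupTheory.PermutationGroups.alternating_fixing_le_of_index_lt_choose`) puts every
even permutation fixing some `T`, `|T| < k`, in it; a `3`-cycle on free columns moves `j'` to `j`.
No Goursat-type argument is needed: each factor of `Sym_n × Sym_n` is treated separately.
-/

-- `Summit.ValiantsHypothesis.ValiantsHypothesis.…` is the tree's mandated single-conjunct layout
-- (Sub = Summit), so the duplicated namespace component is intended.
set_option linter.dupNamespace false

noncomputable section

namespace Summit.ValiantsHypothesis.ValiantsHypothesis.Theorems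

open MvPolynomial

/-- **Alternating stabilisation of the monomials of a sparse invariant polynomial.** Let `Sym_n`
act on the index set `Fin n × Fin n` through injective maps `act a` (`act (ab) = act a ∘ act b`,
`act 1 = id`) and let `f` be invariant under the induced renamings. If `f` has fewer than `C(n,k)`
monomials (`n > 8`, `1 ≤ k`, `4k ≤ n`), then for every monomial `m` of `f` there is a set `X` of
fewer than `k` indices such that every even permutation fixing `X` pointwise fixes `m`: the orbit
of `m` lies in the support, so the stabiliser of `m` has index `≤ |supp f| < C(n,k)`, and
Dixon–Mortimer 5.2B applies. [cite: DixonMortimer1996, Thm 5.2B] -/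
theorem sparseBlocks_altFixing_of_card_support_lt {n k : ℕ} {R : Type*} [CommSemiring R]
    (act : Equiv.Perm (Fin n) → Fin n × Fin n → Fin n × Fin n)
    (hmul : ∀ a b, act (a * b) = act a ∘ act b) (hone : act 1 = id)
    (hinj : ∀ a, Function.Injective (act a))
    (f : MvPolynomial (Fin n × Fin n) R) (hf : ∀ a, rename (act a) f = f)
    (hn : 8 < n) (hk : 1 ≤ k) (h4k : 4 * k ≤ n) (hcard : f.support.card < n.choose k)
    {m : (Fin n × Fin n) →₀ ℕ} (hm : m ∈ f.support) :
    ∃ X : Finset (Fin n), X.card < k ∧ ∀ ρ : Equiv.Perm (Fin n), (∀ x ∈ X, ρ x = x) →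
      Equiv.Perm.sign ρ = 1 → Finsupp.mapDomain (act ρ) m = m := by
  -- the orbit of `m` stays in the support
  have hmem : ∀ a, Finsupp.mapDomain (act a) m ∈ f.support := by
    intro a
    rw [mem_support_iff, ← hf a, coeff_rename_mapDomain _ (hinj a)]
    exact mem_support_iff.1 hm
  have hmul' : ∀ a b, Finsupp.mapDomain (act (a * b)) m =
      Finsupp.mapDomain (act a) (Finsupp.mapDomain (act b) m) := by
    intro a b
    rw [hmul, Finsupp.mapDomain_comp]
  -- the stabiliser of `m`
  let S : Subgroup (Equiv.Perm (Fin n)) :=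
    { carrier := {a | Finsupp.mapDomain (act a) m = m}
      mul_mem' := by
        intro a b ha hb
        simp only [Set.mem_setOf_eq] at ha hb ⊢
        rw [hmul', hb, ha]
      one_mem' := by
        simp only [Set.mem_setOf_eq]
        rw [hone, Finsupp.mapDomain_id]
      inv_mem' := by
        intro a ha
        simp only [Set.mem_setOf_eq] at ha ⊢
        have h := congrArg (Finsupp.mapDomain (act a⁻¹)) ha
        rwa [← hmul', inv_mul_cancel, hone, Finsupp.mapDomain_id, eq_comm] at h }
  have hS : ∀ a, a ∈ S ↔ Finsupp.mapDomain (act a) m = m := fun a => Iff.rfl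
  -- orbit–stabiliser counting: `[Sym_n : S] ≤ |supp f|`
  have hidx : S.index < (Fintype.card (Fin n)).choose k := by
    rw [Fintype.card_fin]
    refine lt_of_le_of_lt ?_ hcard
    let φ : Equiv.Perm (Fin n) ⧸ S → f.support := fun q =>
      ⟨Finsupp.mapDomain (act q.out) m, hmem _⟩
    have hφ : Function.Injective φ := by
      intro a b hab
      have hab' : Finsupp.mapDomain (act a.out) m = Finsupp.mapDomain (act b.out) m :=
        congrArg Subtype.val hab
      rw [← QuotientGroup.out_eq' a, ← QuotientGroup.out_eq' b, QuotientGroup.eq, hS, hmul',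
        ← hab', ← hmul', inv_mul_cancel, hone, Finsupp.mapDomain_id]
    calc S.index = Nat.card (Equiv.Perm (Fin n) ⧸ S) := rfl
      _ ≤ Nat.card f.support := Nat.card_le_card_of_injective φ hφ
      _ = f.support.card := by rw [Nat.card_eq_fintype_card, Fintype.card_coe]
  obtain ⟨X, hXk, hX⟩ :=
    Literature.GroupTheory.PermutationGroups.alternating_fixing_le_of_index_lt_choose S k
      (by rwa [Fintype.card_fin]) hk (by rwa [Fintype.card_fin]) hidx
  exact ⟨X, hXk, fun ρ hρ hsign => (hS ρ).1 (hX ρ hρ hsign)⟩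

/-- A `3`-cycle moving `j'` to `j` among the points outside `X` (there is a third free point as
`|X| + 2 < n`): an even permutation fixing `X` pointwise. [folklore] -/
theorem sparseBlocks_exists_even_perm {n k : ℕ} (X : Finset (Fin n)) (hXk : X.card < k)
    (hk : 1 ≤ k) (h4k : 4 * k ≤ n) {j j' : Fin n} (hj : j ∉ X) (hj' : j' ∉ X) (hjj' : j ≠ j') :
    ∃ ρ : Equiv.Perm (Fin n), (∀ x ∈ X, ρ x = x) ∧ Equiv.Perm.sign ρ = 1 ∧ ρ j' = j := by
  -- a third free point
  obtain ⟨j'', hj''⟩ : (insert j (insert j' X))ᶜ.Nonempty := by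
    rw [← Finset.card_pos, Finset.card_compl, Fintype.card_fin]
    have := Finset.card_insert_le j (insert j' X)
    have := Finset.card_insert_le j' X
    omega
  rw [Finset.mem_compl, Finset.mem_insert, not_or, Finset.mem_insert, not_or] at hj''
  obtain ⟨hj''j, hj''j', hj''X⟩ := hj''
  refine ⟨Equiv.swap j j' * Equiv.swap j j'', fun x hx => ?_, ?_, ?_⟩
  · have hxj : x ≠ j := fun h => hj (h ▸ hx)
    have hxj' : x ≠ j' := fun h => hj' (h ▸ hx)
    have hxj'' : x ≠ j'' := fun h => hj''X (h ▸ hx)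
    rw [Equiv.Perm.mul_apply, Equiv.swap_apply_of_ne_of_ne hxj hxj'',
      Equiv.swap_apply_of_ne_of_ne hxj hxj']
  · rw [Equiv.Perm.sign_mul, Equiv.Perm.sign_swap hjj', Equiv.Perm.sign_swap (Ne.symm hj''j)]
    exact Int.units_mul_self _
  · rw [Equiv.Perm.mul_apply, Equiv.swap_apply_of_ne_of_ne hjj'.symm (Ne.symm hj''j'),
      Equiv.swap_apply_right]

/-- **Special columns.** If `f` is invariant under the column permutations `x_ij ↦ x_{i τ(j)}`
and has fewer than `C(n,k)` monomials (`n > 8`, `1 ≤ k`, `4k ≤ n`), every monomial `m` of `f`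
has a set `T` of fewer than `k` columns outside of which its exponent matrix is constant along
each row: `m (i, j) = m (i, j')` for all `i` and all `j, j' ∉ T`. [folklore] -/
theorem sparseBlocks_columns {n k : ℕ} {R : Type*} [CommSemiring R]
    (f : MvPolynomial (Fin n × Fin n) R)
    (hf : ∀ τ : Equiv.Perm (Fin n), rename (fun p : Fin n × Fin n => (p.1, τ p.2)) f = f)
    (hn : 8 < n) (hk : 1 ≤ k) (h4k : 4 * k ≤ n) (hcard : f.support.card < n.choose k)
    {m : (Fin n × Fin n) →₀ ℕ} (hm : m ∈ f.support) :
    ∃ T : Finset (Fin n), T.card < k ∧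
      ∀ i j j' : Fin n, j ∉ T → j' ∉ T → m (i, j) = m (i, j') := by
  have hinj : ∀ τ : Equiv.Perm (Fin n),
      Function.Injective (fun p : Fin n × Fin n => (p.1, τ p.2)) :=
    fun τ p q h => Prod.ext (Prod.mk.inj h).1 (τ.injective (Prod.mk.inj h).2)
  obtain ⟨X, hXk, hX⟩ := sparseBlocks_altFixing_of_card_support_lt
    (fun (τ : Equiv.Perm (Fin n)) (p : Fin n × Fin n) => (p.1, τ p.2)) (fun _ _ => rfl) rfl
    hinj f hf hn hk h4k hcard hm
  refine ⟨X, hXk, fun i j j' hj hj' => ?_⟩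
  rcases eq_or_ne j j' with rfl | hjj'
  · rfl
  obtain ⟨ρ, hfix, hsign, hρj'⟩ := sparseBlocks_exists_even_perm X hXk hk h4k hj hj' hjj'
  have h2 : Finsupp.mapDomain (fun p : Fin n × Fin n => (p.1, ρ p.2)) m = m := hX ρ hfix hsign
  have key : m (i, ρ j') = m (i, j') := by
    have h := Finsupp.mapDomain_apply (hinj ρ) m (i, j')
    rw [h2] at h
    exact h
  rw [hρj'] at key
  exact key

/-- **Special rows.** If `f` is invariant under the row permutations `x_ij ↦ x_{σ(i) j}` and has
fewer than `C(n,k)` monomials (`n > 8`, `1 ≤ k`, `4k ≤ n`), every monomial `m` of `f` has a set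
`S` of fewer than `k` rows outside of which its exponent matrix is constant along each column:
`m (i, j) = m (i', j)` for all `j` and all `i, i' ∉ S`. [folklore] -/
theorem sparseBlocks_rows {n k : ℕ} {R : Type*} [CommSemiring R]
    (f : MvPolynomial (Fin n × Fin n) R)
    (hf : ∀ σ : Equiv.Perm (Fin n), rename (fun p : Fin n × Fin n => (σ p.1, p.2)) f = f)
    (hn : 8 < n) (hk : 1 ≤ k) (h4k : 4 * k ≤ n) (hcard : f.support.card < n.choose k)
    {m : (Fin n × Fin n) →₀ ℕ} (hm : m ∈ f.support) :
    ∃ S : Finset (Fin n), S.card < k ∧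
      ∀ i i' j : Fin n, i ∉ S → i' ∉ S → m (i, j) = m (i', j) := by
  have hinj : ∀ σ : Equiv.Perm (Fin n),
      Function.Injective (fun p : Fin n × Fin n => (σ p.1, p.2)) :=
    fun σ p q h => Prod.ext (σ.injective (Prod.mk.inj h).1) (Prod.mk.inj h).2
  obtain ⟨X, hXk, hX⟩ := sparseBlocks_altFixing_of_card_support_lt
    (fun (σ : Equiv.Perm (Fin n)) (p : Fin n × Fin n) => (σ p.1, p.2)) (fun _ _ => rfl) rfl
    hinj f hf hn hk h4k hcard hm
  refine ⟨X, hXk, fun i i' j hi hi' => ?_⟩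
  rcases eq_or_ne i i' with rfl | hii'
  · rfl
  obtain ⟨ρ, hfix, hsign, hρi'⟩ := sparseBlocks_exists_even_perm X hXk hk h4k hi hi' hii'
  have h2 : Finsupp.mapDomain (fun p : Fin n × Fin n => (ρ p.1, p.2)) m = m := hX ρ hfix hsign
  have key : m (ρ i', j) = m (i', j) := by
    have h := Finsupp.mapDomain_apply (hinj ρ) m (i', j)
    rw [h2] at h
    exact h
  rw [hρi'] at key
  exact key

/-- **Block monomials of a sparse matrix-symmetric polynomial.** If `f` is invariant under
`x_ij ↦ x_{σ(i) τ(j)}` for all `σ, τ ∈ Sym_n` and has fewer than `C(n,k)` monomials (`n > 8`,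
`1 ≤ k`, `4k ≤ n`), every monomial `m` of `f` has fewer than `k` special rows `S` and special
columns `T`: outside `S` the exponent matrix is constant down each column and outside `T` it is
constant along each row (so it is constant on `(Fin n ∖ S) × (Fin n ∖ T)`). [folklore] -/
theorem sparseBlocks_of_biInvariant : ∀ {n k : ℕ} {R : Type} [CommSemiring R]
    (f : MvPolynomial (Fin n × Fin n) R),
    (∀ σ τ : Equiv.Perm (Fin n),
      MvPolynomial.rename (fun p : Fin n × Fin n => (σ p.1, τ p.2)) f = f) →
    8 < n → 1 ≤ k → 4 * k ≤ n → f.support.card < n.choose k →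
    ∀ {m : (Fin n × Fin n) →₀ ℕ}, m ∈ f.support →
    ∃ S T : Finset (Fin n), S.card < k ∧ T.card < k ∧
      (∀ i i' j : Fin n, i ∉ S → i' ∉ S → m (i, j) = m (i', j)) ∧
      (∀ i j j' : Fin n, j ∉ T → j' ∉ T → m (i, j) = m (i, j')) := by
  intro n k R _ f hf hn hk h4k hcard m hm
  have hrow : ∀ σ : Equiv.Perm (Fin n),
      rename (fun p : Fin n × Fin n => (σ p.1, p.2)) f = f := fun σ => by
    have h := hf σ 1
    have e : (fun p : Fin n × Fin n => (σ p.1, (1 : Equiv.Perm (Fin n)) p.2)) =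
        fun p : Fin n × Fin n => (σ p.1, p.2) := funext fun p => by simp
    rwa [e] at h
  have hcol : ∀ τ : Equiv.Perm (Fin n),
      rename (fun p : Fin n × Fin n => (p.1, τ p.2)) f = f := fun τ => by
    have h := hf 1 τ
    have e : (fun p : Fin n × Fin n => ((1 : Equiv.Perm (Fin n)) p.1, τ p.2)) =
        fun p : Fin n × Fin n => (p.1, τ p.2) := funext fun p => by simp
    rwa [e] at h
  obtain ⟨S, hSk, hS⟩ := sparseBlocks_rows f hrow hn hk h4k hcard hm
  obtain ⟨T, hTk, hT⟩ := sparseBlocks_columns f hcol hn hk h4k hcard hm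
  exact ⟨S, T, hSk, hTk, hS, hT⟩

end Summit.ValiantsHypothesis.ValiantsHypothesis.Theorems

end
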